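import Literature.AlgebraicGeometry.Motives.AbelianVarietyCubeBilinear
import Literature.AlgebraicGeometry.Motives.AbelianVarietyTranslationInvariantAmple
import Literature.AlgebraicGeometry.Motives.AbelianVarietyKerRankOfCube
import Literature.AlgebraicGeometry.Motives.AbelianVarietyTorsionCubeProofs
import Literature.NumberTheory.DiophantineGeometry.AVIsogenyFlat
import HarnessLib

/-!
# The orthogonal of an abelian subvariety: closed, a subgroup, `Y ∩ Y^⊥` finite, and
# `dim (Y^⊥)⁰ ≥ dim X - dim Y` by counting torsion (toward Poincaré's reducibility theorem)

Let `K` be algebraically closed, `i : Y ↪ X` an abelian subvariety of the abelian variety `X`, and `L`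
a Cartier divisor on `X`. Granted the three named facts of `Motives/SeesawTheorem`
(`seesaw_isClosed_trivialLocus`, `seesaw_exists_linEquiv_classPullback`,
`theoremOfCube_isOpen_trivialLocus` — the inputs from which the tree proves the theorem of the cube),
this file constructs and studies the **orthogonal** `Y^⊥ ⊆ X` of `Y` with respect to `L`
(Mumford, *Abelian Varieties*, §19, proof of Thm. 1, p. 173: "let `Z` be the connected component of
`{z ; T_z^* L ⊗ L⁻¹ |_Y` is trivial`}`"; Milne 1986, Prop. 12.1, where `Y^⊥` is the kernel of
`A → A^∨ → B^∨`) **without dual abelian varieties**: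

* `psi i L P = (t_P^* L - L)|_Y` and `Phi` — `P ↦ [ψ(P)] ∈ DivCl(Y)` is a homomorphism on `X(K)`
  (`cl_psi`: `[ψ(P)] = Λ(P_Y, i)` is the cubical pairing of `Motives/AbelianVarietyCubeBilinear`, so
  this is the theorem of the square); `cl_pullback_psi_zsmul`: **`[[n]_Y^* ψ(P)] = n • [ψ(P)]`**
  (`[n]_Y ≫ i = iⁿ` in `X(Y)` and `Λ` is additive in the second variable);
* `orthDiv`, `orth i L = Y^⊥` — the trivial locus over `X` of the family
  `(m ∘ (i × 1))^* L - (i ∘ p₁)^* L` on `Y × X`, **closed** by the seesaw theorem (`isClosed_orth`), with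
  `left_closedPoint_mem_orth_iff`: **`P ∈ Y^⊥ ↔ ψ(P) ∼ 0`** for rational `P` (the fibre over a rational
  point is `Y`, `isIso_fst_residuePt`); so `Y^⊥(K) = ker Φ` is a subgroup (`mem_ker_Phi_iff`);
* `finite_preimage_orth` — **`Y ∩ Y^⊥` is finite** for `L` ample
  (`Motives/AbelianVarietyTranslationInvariantAmple.finite_of_forall_translation_linEquiv`);
* `pow_dim_le_of_orth_subset`, `dim_le_dim_add_dim_of_orth_subset` — **`dim X ≤ dim Y + dim B`** for the
  identity component `B` of `Y^⊥` (`Motives/AbelianVarietyIdentityComponent`,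
  `Motives/AbelianVarietyKernelComponent.redSub`): for a prime `ℓ` invertible in `K`, `Φ` maps
  `X[ℓ](K)` (`ℓ^{2 dim X}` points, Görtz–Wedhorn II Prop. 27.188) onto classes killed by `[ℓ]_Y^*`, of
  which there are at most `#Y[ℓ](K) = ℓ^{2 dim Y}` pairwise non-equivalent ones (**the Kummer bound**,
  `Motives/AbelianVarietyKummerBound`), while `ker Φ ∩ X[ℓ](K) ⊆ Y^⊥ = ⋃_{k ≤ m} t_{Q_k}(B)` has at most
  `m · #B[ℓ](K) = m ℓ^{2 dim B}` points; `ℓ → ∞` gives the dimension bound. This replaces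
  "`dim Y^∨ = dim Y`" of the classical proof.

No named facts are introduced; all inputs from the seesaw facts are threaded as hypotheses `hA hB hC`
(through `cubicalStructure_linEquiv_of_seesaw`, `natCard_torsionPoints_of_isAlgClosed_of_seesaw`,
`kerRank_zsmul_id_of_seesaw`, `isIsogeny_zsmul_id_of_seesaw`, `IsIsogeny.flat_toSchemeHom_holds`,
`IsIsogeny.kerRank_eq_finrank_functionFieldOver`).

Mathlib searched (pin): `Subgroup.card_eq_card_quotient_mul_card_subgroup`,
`QuotientGroup.quotientKerEquivRange`, `MonoidHom.restrict`, `Nat.card_le_card_of_injective`,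
`Nat.exists_infinite_primes`, `CharP.char_is_prime_or_zero`, `ringChar.spec` (used).

## References

* D. Mumford, *Abelian Varieties*, TIFR Studies in Mathematics 5, OUP (1970): §19, Thm. 1 and its
  proof (p. 173). [MumfordAV1970]
* J. S. Milne, *Abelian Varieties*, in: Cornell–Silverman (eds.), *Arithmetic Geometry*, Springer
  (1986): Prop. 12.1 and its proof (held copy, PDF p. 189). [Milne1986AbelianVarieties]
* U. Görtz, T. Wedhorn, *Algebraic Geometry II* (2023): Thm. 24.66 (seesaw), Prop. 27.188 (1)
  (`#X[n] = n^{2g}`). [GortzWedhorn2023]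
-/

universe u v

open CategoryTheory CategoryTheory.Limits AlgebraicGeometry MonoidalCategory CartesianMonoidalCategory
open TopologicalSpace Topology

noncomputable section

namespace Literature.AlgebraicGeometry.Motives

open scoped MonObj
open Scheme.IdealSheafData

namespace AbelianVariety

section Orthogonal

variable {K : Type u} [Field K] {X Y : AbelianVariety K} (i : Y ⟶ X) (L : CartierDivisor X.X.left)

/-- `ψ(P) = (t_P^* L - L)|_Y`, a Cartier divisor on `Y` (classes). [folklore] -/
def psi (P : X.Points K) : CartierDivisor Y.X.left :=
  (L.classPullback (X.translation P).left + -L).classPullback (Hom.toSchemeHom i)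

/-- The family `𝓓 = (m ∘ (i × 1))^* L - (i ∘ p₁)^* L` on `Y × X`, whose fibre over `x ∈ X(K)` is
`ψ(x)`. [folklore] -/
def orthDiv : CartierDivisor (Y.X ⊗ X.X).left :=
  L.classPullback ((CartesianMonoidalCategory.fst Y.X X.X ≫ i.hom.hom.hom) *
      CartesianMonoidalCategory.snd Y.X X.X).left +
    -(L.classPullback (CartesianMonoidalCategory.fst Y.X X.X ≫ i.hom.hom.hom).left)

/-- **The orthogonal** `Y^⊥ = {x ∈ X ; (t_x^* L - L)|_Y trivial}`: the trivial locus of `𝓓` over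
`X`. [folklore] -/
def orth : Set X.X.left := CartierDivisor.trivialLocus Y.X X.X (orthDiv i L)

/-- The orthogonal is closed (seesaw, closedness of the trivial locus). [folklore] -/
theorem isClosed_orth (hA : seesaw_isClosed_trivialLocus.{u}) : IsClosed (orth i L) :=
  hA K Y.X X.X (orthDiv i L)

/-- The class of `𝓓` along the slice `y ↦ (y, P)` is `ψ(P)`. [folklore] -/
theorem classPullback_orthDiv_slice_linEquiv (P : X.Points K) :
    ((orthDiv i L).classPullback ((ρ_ Y.X).inv ≫ Y.X ◁ X.unitPoint P).left).LinEquiv (psi i L P) := by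
  set σ := (ρ_ Y.X).inv ≫ Y.X ◁ X.unitPoint P with hσ
  have e1 : σ ≫ CartesianMonoidalCategory.fst _ _ = 𝟙 _ := by rw [hσ]; simp
  have e2 : σ ≫ CartesianMonoidalCategory.snd _ _ = CartesianMonoidalCategory.toUnit _ ≫ X.unitPoint P := by
    rw [hσ]; simp
  have hc : ∀ g : Y.X ⊗ X.X ⟶ X.X, ((L.classPullback g.left).classPullback σ.left).LinEquiv
      (L.classPullback (σ ≫ g).left) := fun g => by
    rw [Over.comp_left]; exact (L.classPullback_comp_linEquiv g.left σ.left).symm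
  unfold orthDiv psi
  refine (CartierDivisor.classPullback_add_linEquiv σ.left _ _).trans ?_
  refine ((hc _).add ((CartierDivisor.classPullback_neg_linEquiv σ.left _).trans (hc _).neg)).trans ?_
  rw [MonObj.comp_mul, ← Category.assoc, e1, Category.id_comp, e2, toUnit_comp_unitPoint,
    mul_comm, ← comp_translation_eq_mul]
  refine CartierDivisor.LinEquiv.symm ?_
  refine (CartierDivisor.classPullback_add_linEquiv _ _ _).trans ?_
  refine CartierDivisor.LinEquiv.add ?_ ?_
  · rw [Over.comp_left]
    exact (L.classPullback_comp_linEquiv _ _).symm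
  · exact CartierDivisor.classPullback_neg_linEquiv _ _

/-- **Membership in the orthogonal at rational points**: `P ∈ Y^⊥ ↔ ψ(P) ∼ 0`. [folklore] -/
theorem left_closedPoint_mem_orth_iff (P : X.Points K) :
    P.left (IsLocalRing.closedPoint K) ∈ orth i L ↔ (psi i L P).LinEquiv 0 := by
  have hP : P.left (IsLocalRing.closedPoint K) = (X.unitPoint P).left (IsLocalRing.closedPoint K) := rfl
  unfold orth
  rw [hP, CartierDivisor.mem_trivialLocus_iff, residuePtι_apply_eq]
  have e : Y.X ◁ (CartesianMonoidalCategory.toUnit (residuePt X.X ((X.unitPoint P).left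
        (IsLocalRing.closedPoint K))) ≫ X.unitPoint P) =
      CartesianMonoidalCategory.fst Y.X _ ≫ (ρ_ Y.X).inv ≫ Y.X ◁ X.unitPoint P := by
    ext <;> simp
  rw [e, Over.comp_left]
  have hc := (orthDiv i L).classPullback_comp_linEquiv ((ρ_ Y.X).inv ≫ Y.X ◁ X.unitPoint P).left
    (CartesianMonoidalCategory.fst Y.X (residuePt X.X ((X.unitPoint P).left (IsLocalRing.closedPoint K)))).left
  haveI := isIso_fst_residuePt Y.X X.X (X.unitPoint P) (IsLocalRing.closedPoint K)
  set f := CartesianMonoidalCategory.fst Y.X (residuePt X.X ((X.unitPoint P).left (IsLocalRing.closedPoint K)))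
  have hslice := classPullback_orthDiv_slice_linEquiv i L P
  constructor
  · intro h
    -- pull back along the inverse of the isomorphism `f`
    have h1 : (((orthDiv i L).classPullback ((ρ_ Y.X).inv ≫ Y.X ◁ X.unitPoint P).left).classPullback
        f.left).LinEquiv 0 := hc.symm.trans h
    have h2 := h1.classPullback_zero (inv f).left
    have h3 := ((orthDiv i L).classPullback ((ρ_ Y.X).inv ≫ Y.X ◁ X.unitPoint P).left).classPullback_comp_linEquiv
      f.left (inv f).left
    rw [← Over.comp_left, IsIso.inv_hom_id, Over.id_left] at h3
    exact hslice.symm.trans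
      ((((orthDiv i L).classPullback _).classPullback_id_linEquiv.symm.trans h3).trans h2)
  · intro h
    exact hc.trans ((hslice.trans h).classPullback_zero _)

variable {Q : Type v} [AddCommGroup Q] {cl : CartierDivisor Y.X.left → Q}
  (hadd : ∀ D E : CartierDivisor Y.X.left, cl (D + E) = cl D + cl E)
  (heq : ∀ D E : CartierDivisor Y.X.left, D.LinEquiv E ↔ cl D = cl E)

include hadd heq in
/-- An additive class map sends `-D` to `-cl D`. [folklore] -/
theorem classMap_neg (D : CartierDivisor Y.X.left) : cl (-D) = -cl D := by
  have h : cl (D + -D) = cl 0 := (heq _ _).1 (D.add_neg_sameDivisor).linEquiv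
  rw [hadd, CartierDivisor.classMap_zero hadd heq] at h
  exact eq_neg_of_add_eq_zero_right h

include hadd heq in
/-- **`cl ψ(P) = Λ(P_Y, i)`**: the class of `(t_P^*L - L)|_Y` is the cubical pairing of the constant
point `Y → Spec K →P X` with `i : Y → X`. [folklore] -/
theorem cl_psi (P : X.Points K) : cl (psi i L P) = Lam L cl (toSpecOver Y.X ≫ P) i.hom.hom.hom := by
  unfold psi
  rw [(heq _ _).1 (CartierDivisor.classPullback_add_linEquiv _ _ _), hadd,
    (heq _ _).1 (CartierDivisor.classPullback_neg_linEquiv _ _), classMap_neg hadd heq,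
    ← sub_eq_add_neg]
  exact cl_classPullback_translation_sub hadd heq i.hom.hom.hom P

include hadd heq in
/-- `cl ψ(P Q) = cl ψ(P) + cl ψ(Q)` (biadditivity of the cubical pairing; equivalently the theorem
of the square). [folklore] -/
theorem cl_psi_mul (hcube : X.cubicalStructure_linEquiv) (P P' : X.Points K) :
    cl (psi i L (P * P')) = cl (psi i L P) + cl (psi i L P') := by
  rw [cl_psi i L hadd heq, cl_psi i L hadd heq, cl_psi i L hadd heq, MonObj.comp_mul]
  exact Lam_mul_left hadd heq hcube _ _ _

include hadd heq in
/-- `cl ψ(1) = 0`. [folklore] -/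
theorem cl_psi_one : cl (psi i L 1) = 0 := by
  rw [cl_psi i L hadd heq, MonObj.comp_one]
  exact Lam_one_left heq hadd _

/-- **`Φ : X(K) → DivCl(Y)`, `P ↦ [ψ(P)]`, a homomorphism.** [folklore] -/
def Phi (hcube : X.cubicalStructure_linEquiv) : X.Points K →* Multiplicative Q where
  toFun P := Multiplicative.ofAdd (cl (psi i L P))
  map_one' := by rw [cl_psi_one i L hadd heq]; rfl
  map_mul' P P' := by rw [cl_psi_mul i L hadd heq hcube]; rfl

/-- The value of `Φ`. [folklore] -/
theorem Phi_apply (hcube : X.cubicalStructure_linEquiv) (P : X.Points K) :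
    Phi i L hadd heq hcube P = Multiplicative.ofAdd (cl (psi i L P)) := rfl

include hadd heq in
/-- `P ∈ ker Φ ↔ ψ(P) ∼ 0 ↔ P ∈ Y^⊥`. [folklore] -/
theorem mem_ker_Phi_iff (hcube : X.cubicalStructure_linEquiv) (P : X.Points K) :
    P ∈ (Phi i L hadd heq hcube).ker ↔ P.left (IsLocalRing.closedPoint K) ∈ orth i L := by
  rw [MonoidHom.mem_ker, Phi_apply, left_closedPoint_mem_orth_iff, heq,
    CartierDivisor.classMap_zero hadd heq]
  exact ⟨fun h => Multiplicative.ofAdd.injective h, fun h => congrArg _ h⟩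

include hadd heq in
/-- **`[n]_Y^* ψ(P)` has class `n • cl ψ(P)`** (`[n]_Y ≫ i = i ≫ [n]_X = i^n` in `X(Y)`, and the
cubical pairing is additive in the second variable). [folklore] -/
theorem cl_pullback_psi_zsmul (hcube : X.cubicalStructure_linEquiv) (n : ℕ)
    [IsDominant (Hom.toSchemeHom ((n : ℤ) • 𝟙 Y))] (P : X.Points K) :
    cl ((psi i L P).pullback (Hom.toSchemeHom ((n : ℤ) • 𝟙 Y))) = n • cl (psi i L P) := by
  rw [← (heq _ _).1 (CartierDivisor.classPullback_linEquiv_pullback _ _)]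
  have hcomm : Hom.toSchemeHom ((n : ℤ) • 𝟙 Y) ≫ Hom.toSchemeHom i =
      (i.hom.hom.hom ^ n).left := by
    change Hom.toSchemeHom (((n : ℤ) • 𝟙 Y) ≫ i) = _
    rw [Preadditive.zsmul_comp, Category.id_comp, ← Category.comp_id i, ← Preadditive.comp_zsmul,
      Category.comp_id]
    change (i.hom.hom.hom ≫ ((n : ℤ) • 𝟙 X).hom.hom.hom).left = _
    rw [natCast_zsmul, comp_nsmul_id]
  unfold psi
  rw [← (heq _ _).1 (CartierDivisor.classPullback_comp_linEquiv _ _ _), hcomm,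
    (heq _ _).1 (CartierDivisor.classPullback_add_linEquiv _ _ _), hadd,
    (heq _ _).1 (CartierDivisor.classPullback_neg_linEquiv _ _), classMap_neg hadd heq,
    ← sub_eq_add_neg, cl_classPullback_translation_sub hadd heq, Lam_pow_right hadd heq hcube]
  congr 1
  exact (cl_psi i L hadd heq P).symm

end Orthogonal

section PoincareCount

variable {K : Type u} [Field K] [IsAlgClosed K] {X Y : AbelianVariety K} (i : Y ⟶ X)
  [IsClosedImmersion (Hom.toSchemeHom i)] (L : CartierDivisor X.X.left)

omit [IsAlgClosed K] [IsClosedImmersion (Hom.toSchemeHom i)] in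
/-- The point of `(P ≫ i)` is `i` of the point of `P`. [folklore] -/
theorem comp_left_closedPoint (P : Y.Points K) :
    (P ≫ i.hom.hom.hom).left (IsLocalRing.closedPoint K) =
      (Hom.toSchemeHom i) (P.left (IsLocalRing.closedPoint K)) := by
  rw [Over.comp_left, Scheme.Hom.comp_apply]

/-- **`Y ∩ Y^⊥` is finite** for `L` ample, granted the seesaw facts: the closed subgroup
`i⁻¹(Y^⊥) ⊆ Y` consists of the `y` with `(t_y^* L - L)|_Y ∼ 0`
(`finite_of_forall_translation_linEquiv`). [folklore] -/
theorem finite_preimage_orth (hA : seesaw_isClosed_trivialLocus.{u})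
    (hB : seesaw_exists_linEquiv_classPullback.{u}) (hcube : X.cubicalStructure_linEquiv)
    (hL : L.IsAmple) : ((Hom.toSchemeHom i) ⁻¹' orth i L).Finite := by
  obtain ⟨Q, _, cl, hadd, heq⟩ := CartierDivisor.exists_classMap Y.X.left
  set Φ := Phi i L hadd heq hcube with hΦ
  have hmem : ∀ P : Y.Points K, P.left (IsLocalRing.closedPoint K) ∈ (Hom.toSchemeHom i) ⁻¹' orth i L ↔
      P ≫ i.hom.hom.hom ∈ Φ.ker := fun P => by
    rw [Set.mem_preimage, ← comp_left_closedPoint, mem_ker_Phi_iff]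
  refine finite_of_forall_translation_linEquiv hA hB i hL
    ((isClosed_orth i L hA).preimage (Hom.toSchemeHom i).continuous) ?_ ?_ ?_ ?_
  · rw [Set.mem_preimage, toSchemeHom_origin, ← one_left_closedPoint, ← mem_ker_Phi_iff i L hadd heq hcube]
    exact one_mem _
  · intro P P' hP hP'
    rw [hmem] at hP hP' ⊢
    rw [MonObj.mul_comp]
    exact mul_mem hP hP'
  · intro P hP
    rw [hmem] at hP ⊢
    rw [GrpObj.inv_comp]
    exact inv_mem hP
  · intro P hP
    rw [hmem, mem_ker_Phi_iff, left_closedPoint_mem_orth_iff] at hP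
    exact hP

variable {i L}

/-- A rational point of `X` on a translate `t_Q(C)` of the identity component is `Q · j(b)` for a
rational point `b` of the identity component. [folklore] -/
theorem exists_eq_mul_comp_of_mem_image {C : Closeds X.X.left} (hC : IsIrreducible (C : Set X.X.left))
    (h1 : origin X ∈ C) (hδ : Set.range ((redSubι C ⊗ₘ redSubι C) ≫ divMor X).left ⊆ C)
    (Qk : X.Points K) (P : X.Points K)
    (hP : P.left (IsLocalRing.closedPoint K) ∈ (X.translation Qk).left '' (C : Set X.X.left)) :
    ∃ b : (redSub C hC h1 hδ).Points K, Qk * (b ≫ (redSubHom C hC h1 hδ).hom.hom.hom) = P := by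
  obtain ⟨c, hcC, hc⟩ := hP
  -- `c` is a closed point of `X` on `C`, hence a closed point of the subvariety
  have hPcl : IsClosed ({P.left (IsLocalRing.closedPoint K)} : Set X.X.left) := by
    have e : P.left (IsLocalRing.closedPoint K) = (X.translation P).left (origin X) := by
      rw [← one_left_closedPoint, ← Scheme.Hom.comp_apply, ← Over.comp_left, comp_translation, mul_one]
    rw [e, ← Set.image_singleton]
    exact (X.translation P).left.homeomorph.isClosedMap _ (isClosed_singleton_origin X)
  have hccl : IsClosed ({c} : Set X.X.left) := by
    have e : ({c} : Set X.X.left) = (X.translation Qk).left ⁻¹' {P.left (IsLocalRing.closedPoint K)} := by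
      ext x
      simp only [Set.mem_singleton_iff, Set.mem_preimage]
      constructor
      · rintro rfl; exact hc
      · intro hx; exact (X.translation Qk).left.homeomorph.injective (hx.trans hc.symm)
    rw [e]
    exact hPcl.preimage (X.translation Qk).left.continuous
  have hcr : c ∈ Set.range (redSubι C).left := by rw [range_redSubι_left]; exact hcC
  obtain ⟨b', rfl⟩ := hcr
  have hb'cl : IsClosed ({b'} : Set (redSubOver C).left) := by
    have e : ({b'} : Set (redSubOver C).left) = (redSubι C).left ⁻¹' {(redSubι C).left b'} := by
      ext x
      simp only [Set.mem_singleton_iff, Set.mem_preimage]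
      constructor
      · rintro rfl; rfl
      · intro hx; exact (redSubι C).left.isClosedEmbedding.injective hx
    rw [e]; exact hccl.preimage (redSubι C).left.continuous
  set B := redSub C hC h1 hδ
  let b : B.Points K := B.pointOfClosed b' hb'cl
  have hb : b.left (IsLocalRing.closedPoint K) = b' := B.pt_pointOfClosed b' hb'cl
  refine ⟨b, X.eq_of_left_closedPoint_eq _ _ ?_⟩
  rw [← comp_translation, Over.comp_left, Scheme.Hom.comp_apply, Over.comp_left, Scheme.Hom.comp_apply, hb]
  exact hc

/-- Injectivity of `b ↦ j(b)` on rational points of the identity component. [folklore] -/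
theorem comp_redSubHom_injective {C : Closeds X.X.left} (hC : IsIrreducible (C : Set X.X.left))
    (h1 : origin X ∈ C) (hδ : Set.range ((redSubι C ⊗ₘ redSubι C) ≫ divMor X).left ⊆ C) :
    Function.Injective (fun b : (redSub C hC h1 hδ).Points K => b ≫ (redSubHom C hC h1 hδ).hom.hom.hom) :=
  fun _ _ h => (cancel_mono (redSubι C)).1 h

omit [IsClosedImmersion (Hom.toSchemeHom i)] in
/-- **The torsion count.** With `B` the identity component of `Y^⊥` and
`Y^⊥ ⊆ ⋃_{k ∈ I} t_{Q_k}(B)`: for every prime `ℓ` invertible in `K`,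
`ℓ^{2 dim X} ≤ ℓ^{2 dim Y} · (#I · ℓ^{2 dim B})` — the `ℓ`-torsion `X[ℓ](K)` (of order `ℓ^{2 dim X}`)
maps under `Φ` onto at most `ℓ^{2 dim Y}` classes (Kummer bound on `Y`: these classes are killed by
`[ℓ]_Y^*`), and its kernel lies in `Y^⊥`, meeting each translate `t_{Q_k}(B)` in at most `#B[ℓ](K)`
points. [folklore] -/
theorem pow_dim_le_of_orth_subset (hA : seesaw_isClosed_trivialLocus.{u})
    (hB : seesaw_exists_linEquiv_classPullback.{u}) (hC : theoremOfCube_isOpen_trivialLocus.{u})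
    {C : Closeds X.X.left} (hCi : IsIrreducible (C : Set X.X.left)) (h1 : origin X ∈ C)
    (hδ : Set.range ((redSubι C ⊗ₘ redSubι C) ≫ divMor X).left ⊆ C)
    {I : Type u} [Finite I] (Qk : I → X.Points K)
    (hcov : orth i L ⊆ ⋃ k, (X.translation (Qk k)).left '' (C : Set X.X.left))
    {ℓ : ℕ} (hℓ : ℓ.Prime) (hℓK : (ℓ : K) ≠ 0) :
    ℓ ^ (2 * X.dim) ≤ ℓ ^ (2 * Y.dim) * (Nat.card I * ℓ ^ (2 * (redSub C hCi h1 hδ).dim)) := by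
  classical
  have hcube : X.cubicalStructure_linEquiv := X.cubicalStructure_linEquiv_of_seesaw hA hB hC
  set B := redSub C hCi h1 hδ with hBdef
  set jO := (redSubHom C hCi h1 hδ).hom.hom.hom with hjO
  have hℓ0 : ℓ ≠ 0 := hℓ.ne_zero
  have hℓZ : ((ℓ : ℤ) : K) ≠ 0 := by exact_mod_cast hℓK
  -- torsion counts
  have hcardX : Nat.card (X.torsionPoints K ℓ) = ℓ ^ (2 * X.dim) := by
    have := natCard_torsionPoints_of_isAlgClosed_of_seesaw X K hA hB hC (ℓ : ℤ) hℓZ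
    simpa using this
  have hcardY : Nat.card (Y.torsionPoints K ℓ) = ℓ ^ (2 * Y.dim) := by
    have := natCard_torsionPoints_of_isAlgClosed_of_seesaw Y K hA hB hC (ℓ : ℤ) hℓZ
    simpa using this
  have hcardB : Nat.card (B.torsionPoints K ℓ) = ℓ ^ (2 * B.dim) := by
    have := natCard_torsionPoints_of_isAlgClosed_of_seesaw B K hA hB hC (ℓ : ℤ) hℓZ
    simpa using this
  haveI : Finite (X.torsionPoints K ℓ) := Nat.finite_of_card_ne_zero (by rw [hcardX]; positivity)
  haveI : Finite (Y.torsionPoints K ℓ) := Nat.finite_of_card_ne_zero (by rw [hcardY]; positivity)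
  haveI : Finite (B.torsionPoints K ℓ) := Nat.finite_of_card_ne_zero (by rw [hcardB]; positivity)
  -- `[ℓ]_Y` is an isogeny: flat, surjective, finite, of function-field degree `#Y[ℓ](K)`
  have hisoY : IsIsogeny ((ℓ : ℤ) • 𝟙 Y) := isIsogeny_zsmul_id_of_seesaw Y hA hB hC (ℓ : ℤ) (by exact_mod_cast hℓ0)
  haveI : Surjective (Hom.toSchemeHom ((ℓ : ℤ) • 𝟙 Y)) := hisoY.1
  haveI : IsFinite (Hom.toSchemeHom ((ℓ : ℤ) • 𝟙 Y)) := hisoY.2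
  haveI : Flat (Hom.toSchemeHom ((ℓ : ℤ) • 𝟙 Y)) := IsIsogeny.flat_toSchemeHom_holds hisoY
  haveI : IsDominant (Hom.toSchemeHom ((ℓ : ℤ) • 𝟙 Y)) := inferInstance
  have hdegY : Module.finrank Y.X.left.functionField
      (FunctionFieldOver (Hom.toSchemeHom ((ℓ : ℤ) • 𝟙 Y))) = Nat.card (Y.torsionPoints K ℓ) := by
    rw [← hisoY.kerRank_eq_finrank_functionFieldOver, kerRank_zsmul_id_of_seesaw Y hA hB hC (ℓ : ℤ)
      (by exact_mod_cast hℓ0), hcardY]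
    simp
  -- the class group of `Y` and `Φ` on the `ℓ`-torsion
  obtain ⟨Q, _, cl, hadd, heq⟩ := CartierDivisor.exists_classMap Y.X.left
  set Φ := Phi i L hadd heq hcube with hΦ
  set G := X.torsionPoints K ℓ with hG
  set Φℓ : G →* Multiplicative Q := Φ.restrict G with hΦℓ
  have hpowG : ∀ P : G, (P : X.Points K) ^ ℓ = 1 := fun P => by
    have := (mem_torsionPoints_iff _ _).1 P.2; rwa [zpow_natCast] at this
  -- |G| = |ker| * |range|
  have hsplit : Nat.card G = Nat.card Φℓ.ker * Nat.card Φℓ.range := by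
    rw [Subgroup.card_eq_card_quotient_mul_card_subgroup Φℓ.ker, mul_comm,
      Nat.card_congr (QuotientGroup.quotientKerEquivRange Φℓ).toEquiv]
  -- (1) the range has at most `ℓ^{2 dim Y}` elements (Kummer bound on `Y`)
  have hrange : Nat.card Φℓ.range ≤ ℓ ^ (2 * Y.dim) := by
    haveI : Finite Φℓ.range := Finite.of_surjective Φℓ.rangeRestrict Φℓ.rangeRestrict_surjective
    haveI := Fintype.ofFinite Φℓ.range
    have hrep : ∀ c : Φℓ.range, ∃ P : G, Φℓ P = c.1 := fun c => c.2
    choose rep hrep using hrep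
    let E : Φℓ.range → CartierDivisor Y.X.left := fun c => psi i L (rep c).1
    have hE : ∀ c ∈ (Finset.univ : Finset Φℓ.range),
        ((E c).pullback (Hom.toSchemeHom ((ℓ : ℤ) • 𝟙 Y))).LinEquiv 0 := fun c _ => by
      rw [heq, CartierDivisor.classMap_zero hadd heq, cl_pullback_psi_zsmul i L hadd heq hcube]
      have h2 : Φ ((rep c : X.Points K) ^ ℓ) = (Φ (rep c : X.Points K)) ^ ℓ := map_pow _ _ _
      rw [hpowG, map_one, Phi_apply] at h2
      have h3 : Multiplicative.ofAdd (ℓ • cl (psi i L (rep c).1)) = 1 := by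
        rw [ofAdd_nsmul]; exact h2.symm
      exact Multiplicative.ofAdd.injective h3
    have hne : ∀ c ∈ (Finset.univ : Finset Φℓ.range), ∀ c' ∈ (Finset.univ : Finset Φℓ.range),
        (E c).LinEquiv (E c') → c = c' := fun c _ c' _ hcc' => by
      have e : cl (psi i L (rep c).1) = cl (psi i L (rep c').1) := (heq _ _).1 hcc'
      have e2 : Φℓ (rep c) = Φℓ (rep c') := by
        change Φ (rep c).1 = Φ (rep c').1
        rw [Phi_apply, Phi_apply, e]
      exact Subtype.ext ((hrep c).symm.trans (e2.trans (hrep c')))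
    have h := Y.card_le_natCard_torsionPoints_of_pullback_linEquiv_zero (n := ℓ) hℓ.pos hdegY
      Finset.univ E hE hne
    rw [Finset.card_univ, ← Nat.card_eq_fintype_card, hcardY] at h
    exact h
  -- (2) the kernel has at most `#I · ℓ^{2 dim B}` elements
  have hker : Nat.card Φℓ.ker ≤ Nat.card I * ℓ ^ (2 * B.dim) := by
    -- every kernel element lies on some translate `t_{Q_k}(C)`
    have hk : ∀ P : Φℓ.ker, ∃ k : I, ((P : G) : X.Points K).left (IsLocalRing.closedPoint K) ∈
        (X.translation (Qk k)).left '' (C : Set X.X.left) := fun P => by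
      have hP : ((P : G) : X.Points K) ∈ Φ.ker := by
        have := P.2; rwa [MonoidHom.mem_ker] at this ⊢
      rw [mem_ker_Phi_iff] at hP
      simpa only [Set.mem_iUnion] using hcov hP
    choose κ hκ using hk
    have hb : ∀ P : Φℓ.ker, ∃ b : B.Points K, Qk (κ P) * (b ≫ jO) = ((P : G) : X.Points K) := fun P =>
      exists_eq_mul_comp_of_mem_image hCi h1 hδ (Qk (κ P)) _ (hκ P)
    choose β hβ using hb
    -- base points of the nonempty fibres
    have hbase : ∀ k : I, ∃ b₀ : B.Points K, (∃ P : Φℓ.ker, κ P = k) → ∃ P : Φℓ.ker, κ P = k ∧ β P = b₀ := by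
      intro k
      by_cases h : ∃ P : Φℓ.ker, κ P = k
      · obtain ⟨P, hP⟩ := h; exact ⟨β P, fun _ => ⟨P, hP, rfl⟩⟩
      · exact ⟨1, fun h' => (h h').elim⟩
    choose b₀ hb₀ using hbase
    -- the injection `P ↦ (κ P, β P · b₀(κ P)⁻¹)` into `I × B[ℓ](K)`
    have htors : ∀ P : Φℓ.ker, β P * (b₀ (κ P))⁻¹ ∈ B.torsionPoints K ℓ := fun P => by
      obtain ⟨P₀, hP₀, hβP₀⟩ := hb₀ (κ P) ⟨P, rfl⟩
      rw [mem_torsionPoints_iff, zpow_natCast]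
      apply comp_redSubHom_injective hCi h1 hδ
      change ((β P * (b₀ (κ P))⁻¹) ^ ℓ) ≫ jO = (1 : B.Points K) ≫ jO
      rw [MonObj.pow_comp, MonObj.one_comp, MonObj.mul_comp, GrpObj.inv_comp, ← hβP₀]
      have e1 : β P ≫ jO = (Qk (κ P))⁻¹ * ((P : G) : X.Points K) := by
        rw [← hβ P, ← mul_assoc, inv_mul_cancel, one_mul]
      have e2 : β P₀ ≫ jO = (Qk (κ P))⁻¹ * ((P₀ : G) : X.Points K) := by
        rw [← hβ P₀, hP₀, ← mul_assoc, inv_mul_cancel, one_mul]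
      rw [e1, e2, mul_inv_rev, inv_inv]
      have hc : (Qk (κ P))⁻¹ * ((P : G) : X.Points K) * ((((P₀ : G) : X.Points K))⁻¹ * Qk (κ P)) =
          ((P₀ : G) : X.Points K)⁻¹ * ((P : G) : X.Points K) := by
        calc (Qk (κ P))⁻¹ * ((P : G) : X.Points K) * ((((P₀ : G) : X.Points K))⁻¹ * Qk (κ P))
            = (Qk (κ P))⁻¹ * Qk (κ P) * ((((P₀ : G) : X.Points K))⁻¹ * ((P : G) : X.Points K)) := by
              ac_rfl
          _ = _ := by rw [inv_mul_cancel, one_mul]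
      rw [hc, mul_pow, inv_pow, hpowG, hpowG, inv_one, one_mul]
    let F : Φℓ.ker → I × B.torsionPoints K ℓ := fun P => (κ P, ⟨β P * (b₀ (κ P))⁻¹, htors P⟩)
    have hF : Function.Injective F := by
      intro P P' hPP'
      simp only [F, Prod.mk.injEq, Subtype.mk.injEq] at hPP'
      obtain ⟨hk, hbb⟩ := hPP'
      rw [hk] at hbb
      have hbb' : β P = β P' := mul_right_cancel hbb
      apply Subtype.ext; apply Subtype.ext
      rw [← hβ P, ← hβ P', hk, hbb']
    calc Nat.card Φℓ.ker ≤ Nat.card (I × B.torsionPoints K ℓ) := Nat.card_le_card_of_injective F hF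
      _ = Nat.card I * ℓ ^ (2 * B.dim) := by rw [Nat.card_prod, hcardB]
  -- combine
  calc ℓ ^ (2 * X.dim) = Nat.card G := hcardX.symm
    _ = Nat.card Φℓ.ker * Nat.card Φℓ.range := hsplit
    _ ≤ (Nat.card I * ℓ ^ (2 * B.dim)) * ℓ ^ (2 * Y.dim) := Nat.mul_le_mul hker hrange
    _ = ℓ ^ (2 * Y.dim) * (Nat.card I * ℓ ^ (2 * B.dim)) := by ring

omit [IsClosedImmersion (Hom.toSchemeHom i)] in
/-- **The identity component of `Y^⊥` has dimension at least `dim X - dim Y`.** [folklore] -/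
theorem dim_le_dim_add_dim_of_orth_subset (hA : seesaw_isClosed_trivialLocus.{u})
    (hB : seesaw_exists_linEquiv_classPullback.{u}) (hC : theoremOfCube_isOpen_trivialLocus.{u})
    {C : Closeds X.X.left} (hCi : IsIrreducible (C : Set X.X.left)) (h1 : origin X ∈ C)
    (hδ : Set.range ((redSubι C ⊗ₘ redSubι C) ≫ divMor X).left ⊆ C)
    {I : Type u} [Finite I] (Qk : I → X.Points K)
    (hcov : orth i L ⊆ ⋃ k, (X.translation (Qk k)).left '' (C : Set X.X.left)) :
    X.dim ≤ Y.dim + (redSub C hCi h1 hδ).dim := by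
  set m := Nat.card I with hm
  set p := ringChar K with hp
  -- a prime `ℓ > max m p`
  obtain ⟨ℓ, hℓge, hℓ⟩ := Nat.exists_infinite_primes (max m p + 1)
  have hℓm : m < ℓ := by omega
  have hℓp : p < ℓ := by omega
  have hℓK : (ℓ : K) ≠ 0 := by
    intro h0
    rw [ringChar.spec K ℓ] at h0
    rcases CharP.char_is_prime_or_zero K p with hpr | hp0
    · have : p = ℓ := (Nat.prime_dvd_prime_iff_eq hpr hℓ).1 h0
      omega
    · rw [← hp, hp0, zero_dvd_iff] at h0
      exact hℓ.ne_zero h0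
  have key := pow_dim_le_of_orth_subset hA hB hC hCi h1 hδ Qk hcov hℓ hℓK
  set dB := (redSub C hCi h1 hδ).dim
  by_contra hlt
  push Not at hlt
  -- `2 dim X ≥ 2 (dim Y + dim B) + 2`
  have h2 : ℓ ^ (2 * Y.dim) * (m * ℓ ^ (2 * dB)) < ℓ ^ (2 * X.dim) := by
    have hℓ1 : 1 < ℓ := hℓ.one_lt
    calc ℓ ^ (2 * Y.dim) * (m * ℓ ^ (2 * dB)) = m * ℓ ^ (2 * Y.dim + 2 * dB) := by ring
      _ < ℓ ^ 2 * ℓ ^ (2 * Y.dim + 2 * dB) := by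
          apply Nat.mul_lt_mul_of_pos_right ?_ (by positivity)
          calc m < ℓ := hℓm
            _ ≤ ℓ ^ 2 := by nlinarith
      _ = ℓ ^ (2 * (Y.dim + dB + 1)) := by ring
      _ ≤ ℓ ^ (2 * X.dim) := Nat.pow_le_pow_right hℓ.pos (by omega)
  exact absurd key (not_le.2 h2)

end PoincareCount

end AbelianVariety

end Literature.AlgebraicGeometry.Motives
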